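import Summits.BirchSwinnertonDyer.BirchSwinnertonDyer.Theses.BiquadraticEisensteinDescent
import Literature.NumberTheory.EllipticCurves.KrizLi2019.TwoPartBSDTwists
import Literature.NumberTheory.EllipticCurves.BSDSelmer
import Literature.NumberTheory.EllipticCurves.QuadraticTwist
import HarnessLib

set_option linter.dupNamespace false
set_option autoImplicit false

/-!
# Sketch (crux-ideate seat 1, g7, round 1) — first lemmas of three crux ideas for
# `HeegnerTwistCouplingInSupply` (stmt-BirchSwinnertonDyer-21381)

C1 `two-adic-transport-heegner-semigroup` · C2 `corner-prime-selmer-shadow` · C3 `order-p-triples-margin`.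
Statements only (`def … : Prop`); nothing asserted, nothing about BSD is proved here.
-/

noncomputable section

open scoped Classical

namespace Summit.BirchSwinnertonDyer.BirchSwinnertonDyer.Cruxes.HeegnerTwistCouplingInSupply.SeatOneG7

open Filter Topology WeierstrassCurve NumberField Literature.NumberTheory.EllipticCurves
  Literature.NumberTheory.EllipticCurves.ModularForms
  Literature.NumberTheory.EllipticCurves.KrizLi2019
  Literature.NumberTheory.EllipticCurves.Rank1Residual

/-! ## C1 — two-adic transport (Kriz–Li FMS Thm 4.3) on the Heegner semigroup `d_{K₀} · 𝒩⁺` -/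

/-- The NEGATIVE half is empty (found by the falsifier j303258, proved by reciprocity): for a CM curve with
`W(ℚ)[2] = 0` every `ℓ ∈ 𝒮` splits in the CM field `ℚ(√−q)` (`a_ℓ` odd ⇒ `ℓ` ordinary), so `d = −∏ ℓᵢ ≡ 1 (4)` has
`(d/q) = −∏(ℓᵢ/q) = −1`: the CM prime `q ∣ N_W` is inert in `ℚ(√d)`, which is therefore never Heegner for `N_W`. -/
def NegativeHalfEmptyG7 : Prop :=
  ∀ (W : WeierstrassCurve ℚ) [W.IsElliptic] [W.IsGloballyMinimal] [NeZero (W.conductorNorm ℤ)],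
    W.HasCM → (∀ Q : W.toAffine.Point, 2 • Q = 0 → Q = 0) →
    ∀ (K₀ : Type) [Field K₀] [NumberField K₀], IsImaginaryQuadratic K₀ →
      SatisfiesHeegnerHypothesis (W.conductorNorm ℤ) K₀ →
    ∀ (K : Type) [Field K] [NumberField K], IsImaginaryQuadratic K → InN W K₀ (NumberField.discr K) →
      ¬ SatisfiesHeegnerHypothesis (W.conductorNorm ℤ) K

/-- Sign match on the POSITIVE half (elementary Jacobi reciprocity; first checkable lemma of C1): for `d > 0`,
`d ≡ 1 (4)`, if every odd prime of `N` is a square mod… i.e. splits in `ℚ(√d)` and `d ≡ 1 (8)` when `2 ∣ N`, then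
`sgn(d) · (N/d) = +1`, so Kriz–Li's third bullet gives `r_an(W^{(d)}) = r_an(W) = 1` and hence
`r_an(W^{(d·d_{K₀})}) = 0`. -/
def HeegnerSignMatchG7 : Prop :=
  ∀ (N : ℕ) (d : ℤ), N ≠ 0 → 0 < d → d % 4 = 1 →
    (∀ ℓ : ℕ, ℓ.Prime → ℓ ∣ N → Odd ℓ → jacobiSym d ℓ = 1) → (2 ∣ N → d % 8 = 1) →
      Int.sign d * jacobiSym (N : ℤ) d.natAbs = 1

/-- C1, the TOTAL `L`-side (v2): under Kriz–Li (★) for `(W, K₀)` with `W(ℚ)[2] = 0` and `r_an(W) = 1`, EVERY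
imaginary quadratic field `K = ℚ(√(d_{K₀}·d))` with `d > 0`, `d ∈ 𝒩(W, K₀)` and `K` Heegner for `N_W` (⟺ every
`ℓ ∣ N_W` split in `ℚ(√d)`) has `L(W^{(d_K)}, 1) ≠ 0`.
(⟸ `thm33_rank_twist` (second + third bullets for `W₂ = W^{(d·d_{K₀})}`) ∧ `HeegnerSignMatchG7` ∧ model-invariance
of `r_an` ∧ `r_an = 0 ↔ L(1) ≠ 0`.) -/
def TwoAdicTotalOnHeegnerG7 : Prop :=
  ∀ (W : WeierstrassCurve ℚ) [W.IsElliptic] [W.IsGloballyMinimal] [NeZero (W.conductorNorm ℤ)],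
    (∀ Q : W.toAffine.Point, 2 • Q = 0 → Q = 0) → W.analyticRank = 1 →
    ∀ (K₀ : Type) [Field K₀] [NumberField K₀], IsImaginaryQuadratic K₀ →
      SatisfiesHeegnerHypothesis (W.conductorNorm ℤ) K₀ →
    ∀ (Dt : ModularParametrizationData W (W.conductorNorm ℤ))
      (H : HeegnerDatum (W.conductorNorm ℤ) (NumberField.discr K₀)) (ι : K₀ →+* ℂ)
      (P : (W.baseChange K₀).toAffine.Point),
      WeierstrassCurve.Affine.Point.map ι.toRatAlgHom P = heegnerPointComplex Dt H →
    ∀ (j : K₀ →ₐ[ℚ] ℚ_[2]), AssumptionStar W Dt K₀ P j →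
    ∀ (d : ℤ), 0 < d → InN W K₀ d →
    ∀ (K : Type) [Field K] [NumberField K], IsImaginaryQuadratic K →
      NumberField.discr K = NumberField.discr K₀ * d → SatisfiesHeegnerHypothesis (W.conductorNorm ℤ) K →
        (W.quadraticTwist (NumberField.discr K : ℚ)).entireLFunction 1 ≠ 0

/-- C1, the residual (H‴) = `C⁺` of this line (class groups and the mod-2 Galois image only; no `L`-function):
on the `W(ℚ)[2] = 0` sub-corner, for every Heegner `K₀` of `N_W` with `2` split, SOME `d > 0` in `𝒩(W, K₀)` gives an
imaginary quadratic `K = ℚ(√(d_{K₀} d))`, Heegner for `N_W`, with `p ∤ h_K`. -/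
def SemigroupIndivisibleSupplyG7 : Prop :=
  ∀ (W : WeierstrassCurve ℚ) [W.IsElliptic] [W.IsGloballyMinimal] (p : ℕ) [Fact p.Prime]
    [NeZero (W.conductorNorm ℤ)],
    (∀ Q : W.toAffine.Point, 2 • Q = 0 → Q = 0) → W.HasCM → W.analyticRank = 1 → 5 ≤ p →
    CMInert W p → ¬ Good W p →
    ∀ (K₀ : Type) [Field K₀] [NumberField K₀], IsImaginaryQuadratic K₀ →
      SatisfiesHeegnerHypothesis (W.conductorNorm ℤ) K₀ →
      ((Ideal.span {(2 : ℤ)}).primesOver (𝓞 K₀)).ncard = 2 →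
    ∃ (d : ℤ) (K : Type) (_ : Field K) (_ : NumberField K),
      0 < d ∧ InN W K₀ d ∧ IsImaginaryQuadratic K ∧ NumberField.discr K = NumberField.discr K₀ * d ∧
        4 < (NumberField.discr K).natAbs ∧ SatisfiesHeegnerHypothesis (W.conductorNorm ℤ) K ∧
        ¬ p ∣ NumberField.classNumber K

/-! ## C2 — the Selmer shadow at the corner prime (Burungale–Tian any-`p` CM converse + `p`-parity) -/

/-- C2, first checkable lemma: for a CM curve `W'/ℚ` (our `W^{(d)}`) and ANY prime `p`, corank `0` of the
`p^∞`-Selmer group gives `L(W', 1) ≠ 0` (⟸ `burungaleTian_analyticRank_eq_zero_of_selmerCorank_eq_zero_of_hasCM`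
∧ `r_an = 0 ↔ L(1) ≠ 0`). -/
def SelmerShadowG7 : Prop :=
  ∀ (W' : WeierstrassCurve ℚ) [W'.IsElliptic] (p : ℕ) [Fact p.Prime],
    W'.HasCM → W'.selmerCorank p = 0 → W'.entireLFunction 1 ≠ 0

/-- C2, the parity upgrade (⟸ `selmerCorank_mod_two_eq` (Dokchitser–Dokchitser) ∧ Cassels–Tate alternating on
`Ш/div` ∧ no rational `p`-torsion): if `r_an(W')` is even and the `𝔽_p`-Selmer group has dimension `≤ 1`, the
`p^∞`-Selmer corank is `0`. -/
def SelmerParityUpgradeG7 : Prop :=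
  ∀ (W' : WeierstrassCurve ℚ) [W'.IsElliptic] (p : ℕ) [Fact p.Prime],
    W'.analyticRank % 2 = 0 → (∀ Q : W'.toAffine.Point, (p : ℤ) • Q = 0 → Q = 0) →
    Nat.card (W'.selmerGroup (p : ℤ)) ≤ p → W'.selmerCorank p = 0

/-- C2, the transferred crux `C⁺_Sel` (no `L`-function; ONE prime `p` on both conjuncts): some Heegner field `K`
of `N_W` with `|d_K| > 4` has `dim_{𝔽_p} Sel_p(W^{(d_K)}/ℚ) ≤ 1` and `p ∤ h_K`. -/
def CPlusSelG7 : Prop :=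
  ∀ (W : WeierstrassCurve ℚ) [W.IsElliptic] [W.IsGloballyMinimal] (p : ℕ) [Fact p.Prime]
    [NeZero (W.conductorNorm ℤ)],
    W.HasCM → W.analyticRank = 1 → 5 ≤ p → CMInert W p → ¬ Good W p →
    (∀ B : ℕ, ∃ (K : Type) (_ : Field K) (_ : NumberField K),
        IsImaginaryQuadratic K ∧ B < (NumberField.discr K).natAbs ∧
          4 < (NumberField.discr K).natAbs ∧
          SatisfiesHeegnerHypothesis (W.conductorNorm ℤ) K ∧ ¬ p ∣ NumberField.classNumber K) →
    ∃ (K : Type) (_ : Field K) (_ : NumberField K),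
      IsImaginaryQuadratic K ∧ 4 < (NumberField.discr K).natAbs ∧
        SatisfiesHeegnerHypothesis (W.conductorNorm ℤ) K ∧
        Nat.card ((W.quadraticTwist (NumberField.discr K : ℚ)).selmerGroup (p : ℤ)) ≤ p ∧
        ¬ p ∣ NumberField.classNumber K

/-! ## C3 — order-`p` classes as norm-form triples; the `(p − 1)`-margin for the lead's `C⁺` -/

/-- The reduced PRIMITIVE norm-form triples of a discriminant `d < 0` and an exponent `p`:
`(a, t, s)` with `2 ≤ a`, `3a² ≤ |d|`, `s ≥ 1`, `t² − d s² = 4 a^p`, PRIMITIVE: `α = (t + s√d)/2` is divisible in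
`𝒪_d` by no rational prime `q ∤ d` (odd `q`: `q ∤ gcd(t,s)`; `q = 2`, `d` odd: not (`t, s` even and `t ≡ s (4)`)).
Without primitivity the classes of every odd order `n` containing a small prime contribute `≈ p/n` triples each —
falsifier j303258: loose count `4.57 · #d` vs `Σ_d (#Cl(d)[5] − 1) = 0.86 · #d` at `X = 2·10⁴`. -/
def normFormTriples (d : ℤ) (p : ℕ) : Set (ℕ × ℤ × ℕ) :=
  {x | 2 ≤ x.1 ∧ 3 * x.1 ^ 2 ≤ d.natAbs ∧ 1 ≤ x.2.2 ∧
    x.2.1 ^ 2 - d * (x.2.2 : ℤ) ^ 2 = 4 * (x.1 : ℤ) ^ p ∧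
    (∀ q : ℕ, q.Prime → Odd q → (q : ℤ) ∣ x.2.1 → q ∣ x.2.2 → (q : ℤ) ∣ d) ∧
    (Odd d → (2 : ℤ) ∣ x.2.1 → 2 ∣ x.2.2 → ¬ (4 : ℤ) ∣ x.2.1 - x.2.2)}

/-- C3, first checkable lemma (elementary: reduced ideal `𝔞 ∈ C`, `𝔞^p = ((t + s√d)/2)`, unique `p`-th roots in
the ideal group): for an imaginary quadratic `K` with `|d_K| > 4` and an odd prime `p`, the number of classes
`C` with `C^p = 1`, minus one, is at most the number of reduced norm-form triples of `(d_K, p)`. -/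
def OrderPTriplesInjectionG7 : Prop :=
  ∀ (K : Type) [Field K] [NumberField K], IsImaginaryQuadratic K → 4 < (NumberField.discr K).natAbs →
    ∀ (p : ℕ), p.Prime → Odd p →
      Nat.card {C : ClassGroup (𝓞 K) // C ^ p = 1} - 1 ≤ (normFormTriples (NumberField.discr K) p).ncard

/-- The Heegner box of level `N` up to `X`: fundamental `d < 0`, `4 < |d| ≤ X`, every prime of `N` split. -/
def InHeegnerBox (N X : ℕ) (d : ℤ) : Prop :=
  ∃ (K : Type) (_ : Field K) (_ : NumberField K), IsImaginaryQuadratic K ∧ NumberField.discr K = d ∧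
    4 < d.natAbs ∧ d.natAbs ≤ X ∧ SatisfiesHeegnerHypothesis N K

/-- C3, the transferred target `C⁺⁺(N, p)` — an UPPER BOUND with a constant-factor margin, no asymptotic: along
some sequence `X → ∞` the total number of reduced norm-form triples over the Heegner box is at most
`(p − 1 − ε) · #box(X)`. (Cohen–Lenstra predicts `≈ 1 · #box(X)`; the margin is the factor `p − 1 ≥ 4`.) -/
def TriplesMarginG7 (N p : ℕ) : Prop :=
  ∃ ε : ℝ, 0 < ε ∧ ∃ᶠ X : ℕ in atTop,
    (Nat.card {x : ℤ × (ℕ × ℤ × ℕ) | InHeegnerBox N X x.1 ∧ x.2 ∈ normFormTriples x.1 p} : ℝ) ≤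
      ((p : ℝ) - 1 - ε) * Nat.card {d : ℤ | InHeegnerBox N X d}

/-- C3, first rung (provable now, elementary counting `O(X^{1/2 + 2/p + ε})`, which is `o(X)` EXACTLY when
`p ≥ 5`): triples whose norm `a` is SMALL relative to the discriminant (`16 a^p ≤ d²`, i.e. `a ≤ (|d|/4)^{2/p}`)
have density zero over the Heegner box. All the mass of `Σ_d (#Cl(d)[p] − 1)` sits in the CUSP `|d| < 4 a^{p/2}`. -/
def SmallNormNegligibleG7 : Prop :=
  ∀ (N p : ℕ), N ≠ 0 → p.Prime → 5 ≤ p →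
    Tendsto (fun X : ℕ ↦ (Nat.card {x : ℤ × (ℕ × ℤ × ℕ) | InHeegnerBox N X x.1 ∧ x.2 ∈ normFormTriples x.1 p ∧
        16 * x.2.1 ^ p ≤ x.1.natAbs ^ 2} : ℝ) / (X : ℝ)) atTop (𝓝 0)

/-- C3, the switch into the lead's currency (elementary counting + `OrderPTriplesInjectionG7` + positive lower
density of the Heegner box among square-free integers): the margin gives the lead's `C⁺(N, p)`
(`stub_nonNullIndivisibleHeegner` of `Lines/size_tail.lean`, hypothesis `hC` of the landed
`heegnerTwistCouplingInSupply_of_nonNull`). -/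
def MarginImpliesNonNullG7 : Prop :=
  ∀ (N p : ℕ), N ≠ 0 → p.Prime → 5 ≤ p → TriplesMarginG7 N p →
    ¬ twistDensity (fun d : ℤ ↦ ∃ (K : Type) (_ : Field K) (_ : NumberField K),
        IsImaginaryQuadratic K ∧ NumberField.discr K = d ∧ 4 < d.natAbs ∧
        SatisfiesHeegnerHypothesis N K ∧ ¬ p ∣ NumberField.classNumber K) 0

end Summit.BirchSwinnertonDyer.BirchSwinnertonDyer.Cruxes.HeegnerTwistCouplingInSupply.SeatOneG7

end
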